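import Literature.NumberTheory.EllipticCurves.ThreeKernelCocycles
import Literature.NumberTheory.EllipticCurves.MordellCurveThreeDescentKernel
import Literature.NumberTheory.EllipticCurves.MordellCurveThreeDescentLocal
import Literature.NumberTheory.EllipticCurves.CPMuDescentShaThree
import Literature.NumberTheory.EllipticCurves.ShaRestriction
import Mathlib.Algebra.QuadraticAlgebra.Basic
import HarnessLib

/-!
# A TWISTED cubic character of `Γ_ℚ`, restricted to a field `L ∌ √−3` with an involution, is the Kummer character of
# an element of cube norm (Cohen–Pazuki 2009, Definition 1.3 «`G₃`», for the twist `ℤ/3 ⊗ χ`; Silverman X.4.2 (a))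

Topic `NumberTheory/EllipticCurves`. Companion of the tree's `K3CubicCharacterNorm` (the case `L = ℚ(ζ₃)`, untwisted
character `n : Γ_ℚ → ℤ/3`), written for the `3`-isogeny descent of a Mordell curve `y² = x³ + k` over `ℚ` whose kernel
`{O, (0, ±√k)}` is NEITHER `ℤ/3` NOR `μ₃` but `ℤ/3 ⊗ χ_k ≅ μ₃ ⊗ χ_{−3k}` (e.g. the Sylvester twists `y² = x³ − 2p²`;
programme memo `Summits/BirchSwinnertonDyer/BirchSwinnertonDyer/Cruxes/HeegnerTwistCouplingInSupply/TWISTED-DESCENT-PROGRAMME-w4g32.md`).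
There a class of `H¹(ℚ, E[φ])` is a cocycle `σ ↦ n(σ)T` with a `ψ`-TWISTED homomorphism `n(στ) = n(σ) + ψ(σ)n(τ)`; on
`Γ_L`, `L = ℚ(√−3k)`, the twist `ψ` IS the mod-`3` cyclotomic sign `ε` (`MordellDescent.eps`), so `n ∘ res` is a Kummer character
`κ_u` up to a coboundary (`ThreeKernelCocycles.exists_kummerExp_eq_add`, already twisted), and the point proved here is
Cohen–Pazuki's NORM CONDITION «`G₃ = {u ∈ L*/L*³ : N(u) ∈ ℚ*³}`» in the twisted setting:

* §1 (`L` any field of characteristic `0`, `c : L ≃+* L` an involution, `c̄` a lift of `c` to `L̄` with `c̄(√−3) = −√−3`):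
  `conjAut c̄ τ = c̄ ∘ τ ∘ c̄⁻¹ ∈ Γ_L`; `eps_conjAut : ε(c̄τc̄⁻¹) = ε(τ)`;
  ★ `kummerExp_conjAut_twisted` : `κ_u(c̄ τ c̄⁻¹) = −κ_{c u}(τ) + (1 − ε τ)·j` (the tree's `kummerExp_conjAut` is the case `ε ≡ 1`);
  ★ `exists_fixed_cube_of_kummerExp_add` : if `κ_u + κ_{cu} ≡ (ε − 1)·J` and `√−3 ∉ L` then `u · c(u) = r³` with `c r = r`
  (`L` has no primitive cube root of unity, so `w³ = c(w)³ ⇒ c(w) = w`);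
  `exists_lift_neg_theta` : such a lift `c̄` EXISTS when `√−3 ∉ L` (`IsAlgClosure.equivOfEquiv`, corrected by an element of
  `Γ_L` moving `√−3`, tree `CPMuDescent.exists_galAut_theta_ne`).
* §2 (`L` a number field): `sigmaTilde c̄ ∈ Γ_ℚ` (transport along `ι = closureEmb`), `resGal_conjAut'`:
  `res(c̄τc̄⁻¹) = σ̃ · res τ · σ̃⁻¹`; for a `ψ`-TWISTED `n` (`n(στ) = nσ + ψσ·nτ`) with `ψ σ̃ = ψ σ̃⁻¹ = 1`:
  `n(res(c̄τc̄⁻¹)) = n(res τ) + (1 − ψ(res τ))·n(σ̃)` (`twistedHom_resGal_conjAut`).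
* §3 ★★ `exists_kummerExp_eq_resGal_twisted` — for a locally constant `ψ`-twisted `n : Γ_ℚ → ℤ/3ℤ` with `ψ ∘ res = ε_L`
  and `ψ(σ̃^{±1}) = 1` there are `u ∈ L*`, `j` with `κ_u = n ∘ res + (ε − 1)j` on `Γ_L` AND `u · c(u) = r³`, `c r = r`
  (for `L = QuadraticAlgebra ℚ a b` and `c = star`, `r ∈ ℚ`: `exists_ratCast_eq_of_star_eq`).

What is NOT here: the `ψ`-twisted kernel image theorem and the Mordell-curve restriction step (next file of the programme),
anything local or global. Everything here is proved; definitions (plumbing, with bodies): `conjAut`, `cbarRat`, `sigmaTilde`;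
no named facts.

## References

* [CohenPazuki2009] H. Cohen, F. Pazuki, *Elementary 3-descent with a 3-isogeny*, Acta Arith. 140 (2009), Definition 1.3
  (`G₃`), Proposition 1.4 (2).
* [SilvermanAEC2009] J. H. Silverman, *AEC*, VIII.§2 (Kummer theory), Thm. X.4.2 (a), X.§4 (restriction).
* Tree: `K3CubicCharacterNorm` (template, verbatim for §2), `ThreeKernelCocycles`, `MordellCurveThreeDescentKernel`
  (`exists_eq_cube_of_kummerExp_eq`), `CPMuDescentShaThree` (`exists_galAut_theta_ne`), `Sha`/`ShaRestriction`
  (`closureEmb`, `resGal`, `algEquivOfEmb`), `MordellCurveThreeDescentLocal` (`galAutE`, `iotaE`, `iotaE_galAut_resGal`).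
-/

noncomputable section

open scoped Classical

namespace Literature.NumberTheory.EllipticCurves

namespace TwistedKummer

open MordellDescent CPMuDescent

universe u

/-! ## §1 A lift `c̄` of an involution `c` of `L` with `c̄(√−3) = −√−3`: conjugating `Γ_L`, Kummer characters -/

section Field

variable {L : Type u} [Field L] [CharZero L] (c : L ≃+* L) (hc2 : ∀ x : L, c (c x) = x)
  (cbar : AlgebraicClosure L ≃+* AlgebraicClosure L)
  (hcbar : ∀ x : L, cbar (algebraMap L (AlgebraicClosure L) x) = algebraMap L (AlgebraicClosure L) (c x))

include hc2 in
omit [CharZero L] in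
/-- An involution is its own inverse. [cite: CohenPazuki2009, Definition 1.3] -/
theorem ringEquiv_symm_apply_of_involutive (x : L) : c.symm x = c x := by
  apply c.injective
  rw [RingEquiv.apply_symm_apply, hc2]

include hc2 hcbar in
omit [CharZero L] in
/-- `c̄⁻¹` restricts to `c` (an involution). [cite: CohenPazuki2009, Definition 1.3] -/
theorem cbar_symm_algebraMap (x : L) :
    cbar.symm (algebraMap L (AlgebraicClosure L) x) = algebraMap L (AlgebraicClosure L) (c x) := by
  apply cbar.injective
  rw [RingEquiv.apply_symm_apply, hcbar, hc2]

/-- **The conjugate `c̄ ∘ τ ∘ c̄⁻¹ ∈ Γ_L`** of `τ ∈ Γ_L` by a lift `c̄` of the involution `c` of `L` (again `L`-linear).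
[cite: CohenPazuki2009, Definition 1.3] -/
def conjAut (hc2 : ∀ x : L, c (c x) = x)
    (hcbar : ∀ x : L, cbar (algebraMap L (AlgebraicClosure L) x) = algebraMap L (AlgebraicClosure L) (c x))
    (τ : Field.absoluteGaloisGroup L) : Field.absoluteGaloisGroup L :=
  AlgEquiv.ofRingEquiv (f := cbar.symm.trans ((galAutE L τ).toRingEquiv.trans cbar)) fun x => by
    change cbar (galAutE L τ (cbar.symm (algebraMap L _ x))) = algebraMap L _ x
    rw [cbar_symm_algebraMap c hc2 cbar hcbar, AlgEquiv.commutes, hcbar, hc2]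

omit [CharZero L] in
/-- `(c̄ τ c̄⁻¹)(x) = c̄ (τ (c̄⁻¹ x))`. [cite: CohenPazuki2009, Definition 1.3] -/
theorem conjAut_apply (τ : Field.absoluteGaloisGroup L) (x : AlgebraicClosure L) :
    galAut (conjAut c cbar hc2 hcbar τ) x = cbar (galAut τ (cbar.symm x)) := rfl

variable (hθ : cbar (theta L) = -theta L)

include hθ in
/-- `c̄⁻¹ (√−3) = −√−3`. [cite: CohenPazuki2009, §1.2] -/
theorem cbar_symm_theta : cbar.symm (theta L) = -theta L := by
  apply cbar.injective
  rw [RingEquiv.apply_symm_apply, map_neg, hθ, neg_neg]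

include hθ in
/-- `c̄ ω = ω²`. [cite: CohenPazuki2009, §1.2] -/
theorem cbar_omega : cbar (omega L) = omega L ^ 2 := by
  rw [omega_sq, omega, map_div₀, map_sub, map_one, map_ofNat, hθ]

include hθ in
/-- `c̄⁻¹ ω = ω²`. [cite: CohenPazuki2009, §1.2] -/
theorem cbar_symm_omega : cbar.symm (omega L) = omega L ^ 2 := by
  rw [omega_sq, omega, map_div₀, map_sub, map_one, map_ofNat, cbar_symm_theta cbar hθ]

include hθ in
/-- **The cyclotomic sign is conjugation-invariant**: `ε(c̄ τ c̄⁻¹) = ε(τ)` (`c̄` and `c̄⁻¹` both negate `√−3`).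
[cite: CohenPazuki2009, §1.2] -/
theorem eps_conjAut (τ : Field.absoluteGaloisGroup L) : eps (conjAut c cbar hc2 hcbar τ) = eps τ := by
  have key : galAut (conjAut c cbar hc2 hcbar τ) (theta L) = galAut τ (theta L) := by
    rw [conjAut_apply, cbar_symm_theta cbar hθ, map_neg, map_neg]
    rcases galAut_theta τ with h | h
    · rw [h, hθ, neg_neg]
    · rw [h, map_neg, hθ, neg_neg]
  unfold eps
  rw [key]

include hθ in
/-- ★ **`κ_u(c̄ τ c̄⁻¹) = −κ_{c u}(τ) + (1 − ε τ)·j`** for `u ∈ L*` (with `c̄⁻¹ ∛u = ω^j ∛(c u)`): the TWISTED form of the tree's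
`kummerExp_conjAut` (there `ε ≡ 1` as `√−3 ∈ K3`): `c̄ τ c̄⁻¹ (∛u) = c̄(ω^{jε(τ) + κ_{cu}(τ)} ∛(cu)) = ω^{2jε(τ) + 2κ_{cu}(τ) + j} ∛u`.
[cite: CohenPazuki2009, Definition 1.3 (G₃)] -/
theorem kummerExp_conjAut_twisted {u : L} (hu : u ≠ 0) : ∃ j : ℕ, ∀ τ : Field.absoluteGaloisGroup L,
    kummerExp u (conjAut c cbar hc2 hcbar τ) = -kummerExp (c u) τ + (1 - eps τ) * j := by
  have hu' : c u ≠ 0 := (map_ne_zero c).mpr hu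
  set ρ := cubeRoot u with hρ
  set ρ' := cubeRoot (c u) with hρ'
  have hρ'0 : ρ' ≠ 0 := cubeRoot_ne_zero hu'
  -- `c̄⁻¹ ρ = ω^j ρ'`
  obtain ⟨j, -, hj⟩ : ∃ j < 3, omega L ^ j = cbar.symm ρ / ρ' := by
    apply exists_pow_eq_of_pow_three_eq_one L
    rw [div_pow, ← map_pow, hρ, cubeRoot_pow_three, cbar_symm_algebraMap c hc2 cbar hcbar, hρ', cubeRoot_pow_three,
      div_self]
    rw [map_ne_zero_iff _ (algebraMap L (AlgebraicClosure L)).injective]; exact hu'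
  have hcρ : cbar.symm ρ = omega L ^ j * ρ' := by rw [hj, div_mul_cancel₀ _ hρ'0]
  have hcρ' : cbar ρ' = omega L ^ j * ρ := by
    have h1 : ρ = cbar (omega L ^ j * ρ') := by rw [← hcρ, RingEquiv.apply_symm_apply]
    rw [map_mul, map_pow, cbar_omega cbar hθ, ← pow_mul] at h1
    have hω3 := omega_pow_three L
    calc cbar ρ' = omega L ^ (3 * j) * cbar ρ' := by rw [pow_mul, hω3, one_pow, one_mul]
      _ = omega L ^ j * (omega L ^ (2 * j) * cbar ρ') := by rw [← mul_assoc, ← pow_add]; ring_nf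
      _ = omega L ^ j * ρ := by rw [← h1]
  refine ⟨j, fun τ => ?_⟩
  set k := (kummerExp (c u) τ).val with hk
  -- the computation: `c̄ τ c̄⁻¹ ρ = ω^{2(j e + k) + j} ρ`, `e = epsNat τ`
  have key : galAut (conjAut c cbar hc2 hcbar τ) ρ = omega L ^ (2 * (j * epsNat τ + k) + j) * ρ := by
    rw [conjAut_apply, hcρ, map_mul, map_pow, galAut_omega, hρ', galAut_cubeRoot hu', ← hk, ← hρ']
    simp only [map_mul, map_pow]
    rw [cbar_omega cbar hθ, hcρ']
    ring
  rw [hρ] at key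
  rw [kummerExp_eq_of_galAut_eq hu key]
  push_cast
  rw [hk, ZMod.natCast_zmod_val, epsNat_cast]
  have h3 : (2 : ZMod 3) = -1 := by decide
  rw [h3]; ring

/-- **No primitive cube root of unity in a field `∌ √−3`**: `w³ = v³`, `v ≠ 0` ⇒ `w = v` (`(w/v)² + (w/v) + 1 = 0` would give
`(2(w/v) + 1)² = −3`). [cite: CohenPazuki2009, §1.2] -/
theorem eq_of_pow_three_eq_of_no_sqrt_neg_three (hL : ∀ q : L, q ^ 2 ≠ -3) {w v : L} (hv : v ≠ 0)
    (h : w ^ 3 = v ^ 3) : w = v := by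
  set z := w / v with hz
  have hz3 : z ^ 3 = 1 := by rw [hz, div_pow, h, div_self (pow_ne_zero 3 hv)]
  have hfac : (z - 1) * (z ^ 2 + z + 1) = 0 := by linear_combination hz3
  rcases mul_eq_zero.mp hfac with h1 | h1
  · have : z = 1 := sub_eq_zero.mp h1
    rw [hz, div_eq_one_iff_eq hv] at this
    exact this
  · exfalso
    exact hL (2 * z + 1) (by linear_combination (4 : L) * h1)

include hc2 in
/-- ★ **The norm condition, twisted form.** If `κ_u(τ) + κ_{cu}(τ) = (ε τ − 1)·J` on `Γ_L` (`√−3 ∉ L`), then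
`u · c(u) = r³` for some `r ∈ L` FIXED by `c`: `κ_{u·cu}` is a coboundary, so `u·cu = w³` (`exists_eq_cube_of_kummerExp_eq`), and
`w³ = c(w)³` forces `c w = w` as `L` has no primitive cube root of unity. [cite: CohenPazuki2009, Definition 1.3 (G₃)] -/
theorem exists_fixed_cube_of_kummerExp_add (hL : ∀ q : L, q ^ 2 ≠ -3) {u : L} (hu : u ≠ 0) {J : ZMod 3}
    (h : ∀ τ : Field.absoluteGaloisGroup L, kummerExp u τ + kummerExp (c u) τ = (eps τ - 1) * J) :
    ∃ r : L, c r = r ∧ r ≠ 0 ∧ u * c u = r ^ 3 := by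
  have hu' : c u ≠ 0 := (map_ne_zero c).mpr hu
  obtain ⟨j, -, hj⟩ := exists_cubeRoot_mul hu hu'
  have hcob : ∀ τ : Field.absoluteGaloisGroup L, kummerExp (u * c u) τ = (eps τ - 1) * (J + j) := by
    intro τ
    rw [kummerExp_mul_left hu hu' hj τ, mul_add, ← h τ]
  obtain ⟨w, hw0, hw⟩ := exists_eq_cube_of_kummerExp_eq (mul_ne_zero hu hu') hcob
  refine ⟨w, ?_, hw0, hw⟩
  -- `c(u·cu) = u·cu`, so `(c w)³ = w³`
  have hfix : c (u * c u) = u * c u := by rw [map_mul, hc2, mul_comm]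
  have h3 : (c w) ^ 3 = w ^ 3 := by rw [← map_pow, ← hw, hfix]
  exact eq_of_pow_three_eq_of_no_sqrt_neg_three hL hw0 h3

include hcbar in
/-- **A lift of `c` to `L̄` negating `√−3` exists** when `√−3 ∉ L`: take any lift (`IsAlgClosure.equivOfEquiv`); if it fixes
`θ = √−3`, precompose with an element of `Γ_L` moving `θ` (tree `exists_galAut_theta_ne`). Stated for the given lift `cbar` as
the dichotomy-free output. [cite: CohenPazuki2009, §1.2] -/
theorem exists_lift_neg_theta (hL : ∀ q : L, q ^ 2 ≠ -3) :
    ∃ cbar' : AlgebraicClosure L ≃+* AlgebraicClosure L,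
      (∀ x : L, cbar' (algebraMap L (AlgebraicClosure L) x) = algebraMap L (AlgebraicClosure L) (c x)) ∧
        cbar' (theta L) = -theta L := by
  rcases (show cbar (theta L) = theta L ∨ cbar (theta L) = -theta L by
    rw [← mul_self_eq_mul_self_iff, ← map_mul, theta_mul_theta, map_neg, map_ofNat]) with h | h
  · obtain ⟨σ₀, hσ₀⟩ := exists_galAut_theta_ne hL
    have hσ₀' : galAut σ₀ (theta L) = -theta L := (galAut_theta σ₀).resolve_left hσ₀
    refine ⟨(galAut σ₀).toRingEquiv.trans cbar, fun x => ?_, ?_⟩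
    · change cbar (galAut σ₀ (algebraMap L _ x)) = _
      rw [AlgEquiv.commutes, hcbar]
    · change cbar (galAut σ₀ (theta L)) = _
      rw [hσ₀', map_neg, h]
  · exact ⟨cbar, hcbar, h⟩

/-- The unconditional existence statement: for an automorphism `c` of a field `L ∌ √−3` there is a lift `c̄` of `c` to `L̄`
with `c̄(√−3) = −√−3`. [cite: CohenPazuki2009, §1.2] -/
theorem exists_lift_neg_theta' (hL : ∀ q : L, q ^ 2 ≠ -3) (c : L ≃+* L) :
    ∃ cbar' : AlgebraicClosure L ≃+* AlgebraicClosure L,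
      (∀ x : L, cbar' (algebraMap L (AlgebraicClosure L) x) = algebraMap L (AlgebraicClosure L) (c x)) ∧
        cbar' (theta L) = -theta L :=
  exists_lift_neg_theta c (IsAlgClosure.equivOfEquiv (AlgebraicClosure L) (AlgebraicClosure L) c)
    (IsAlgClosure.equivOfEquiv_algebraMap _ _ c) hL

end Field

/-! ## §2 Over `ℚ`: conjugation transported to `Γ_ℚ` and twisted characters -/

section OverRat

variable {L : Type} [Field L] [NumberField L] (c : L ≃+* L) (hc2 : ∀ x : L, c (c x) = x)
  (cbar : AlgebraicClosure L ≃+* AlgebraicClosure L)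
  (hcbar : ∀ x : L, cbar (algebraMap L (AlgebraicClosure L) x) = algebraMap L (AlgebraicClosure L) (c x))

/-- `c̄` as a `ℚ`-algebra automorphism of `L̄`. [cite: CohenPazuki2009, Definition 1.3 (G₃)] -/
def cbarRat : AlgebraicClosure L ≃ₐ[ℚ] AlgebraicClosure L :=
  AlgEquiv.ofRingEquiv (f := cbar) fun q => by
    rw [IsScalarTower.algebraMap_apply ℚ L (AlgebraicClosure L), eq_ratCast (algebraMap ℚ L), map_ratCast, map_ratCast]

/-- `cbarRat x = c̄ x`. [cite: CohenPazuki2009, Definition 1.3 (G₃)] -/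
@[simp] theorem cbarRat_apply (x : AlgebraicClosure L) : cbarRat cbar x = cbar x := rfl

/-- **`c̄` transported to `σ̃ ∈ Γ_ℚ`** along the chosen embedding `ι : ℚ̄ ≃ L̄` (`closureEmb`, bijective by `algEquivOfEmb`):
`σ̃ = ι⁻¹ ∘ c̄ ∘ ι`. [cite: CohenPazuki2009, Definition 1.3 (G₃)] -/
def sigmaTilde : Field.absoluteGaloisGroup ℚ :=
  ((algEquivOfEmb L (iotaE (K := ℚ) L)).trans (cbarRat cbar)).trans (algEquivOfEmb L (iotaE (K := ℚ) L)).symm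

/-- `ι (σ̃ x) = c̄ (ι x)`. [cite: CohenPazuki2009, Definition 1.3 (G₃)] -/
theorem iotaE_sigmaTilde (x : AlgebraicClosure ℚ) :
    iotaE (K := ℚ) L (galAut (sigmaTilde cbar) x) = cbar (iotaE (K := ℚ) L x) := by
  change iotaE (K := ℚ) L ((algEquivOfEmb L (iotaE (K := ℚ) L)).symm
    (cbarRat cbar (algEquivOfEmb L (iotaE (K := ℚ) L) x))) = _
  rw [← algEquivOfEmb_apply L (iotaE (K := ℚ) L), AlgEquiv.apply_symm_apply, cbarRat_apply, algEquivOfEmb_apply]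

/-- `ι (σ̃⁻¹ x) = c̄⁻¹ (ι x)`. [cite: CohenPazuki2009, Definition 1.3 (G₃)] -/
theorem iotaE_sigmaTilde_inv (x : AlgebraicClosure ℚ) :
    iotaE (K := ℚ) L (galAut (sigmaTilde cbar)⁻¹ x) = cbar.symm (iotaE (K := ℚ) L x) := by
  apply cbar.injective
  rw [RingEquiv.apply_symm_apply, ← iotaE_sigmaTilde, ← galAut_mul_apply, mul_inv_cancel]
  rfl

/-- **`res(c̄ τ c̄⁻¹) = σ̃ · res(τ) · σ̃⁻¹`** in `Γ_ℚ` (checked after the injective `ι`). [cite: CohenPazuki2009, Definition 1.3 (G₃)] -/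
theorem resGal_conjAut' (τ : Field.absoluteGaloisGroup L) :
    resGal (K := ℚ) L (conjAut c cbar hc2 hcbar τ) =
      sigmaTilde cbar * resGal (K := ℚ) L τ * (sigmaTilde cbar)⁻¹ := by
  apply AlgEquiv.ext
  intro x
  apply (iotaE (K := ℚ) L).injective
  change iotaE (K := ℚ) L (galAut (resGal (K := ℚ) L (conjAut c cbar hc2 hcbar τ)) x) =
    iotaE (K := ℚ) L (galAut (sigmaTilde cbar * resGal (K := ℚ) L τ * (sigmaTilde cbar)⁻¹) x)
  rw [iotaE_galAut_resGal, galAut_mul_apply, galAut_mul_apply, iotaE_sigmaTilde, iotaE_galAut_resGal, iotaE_sigmaTilde_inv]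
  rfl

/-- **Twisted homomorphisms under conjugation.** For `n : Γ_ℚ → ℤ/3ℤ` with `n(στ) = n(σ) + ψ(σ) n(τ)`, `ψ` multiplicative into
`{±1}` with `ψ(σ̃) = ψ(σ̃⁻¹) = 1`: `n(res(c̄τc̄⁻¹)) = n(res τ) + (1 − ψ(res τ))·n(σ̃)`. [cite: CohenPazuki2009, Definition 1.3 (G₃)] -/
theorem twistedHom_resGal_conjAut (n ψ : Field.absoluteGaloisGroup ℚ → ZMod 3)
    (hn : ∀ σ τ, n (σ * τ) = n σ + ψ σ * n τ) (hψmul : ∀ σ τ, ψ (σ * τ) = ψ σ * ψ τ)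
    (hψ1 : ψ (sigmaTilde cbar) = 1) (hψ2 : ψ (sigmaTilde cbar)⁻¹ = 1)
    (hψsq : ∀ σ, ψ σ * ψ σ = 1) (τ : Field.absoluteGaloisGroup L) :
    n (resGal (K := ℚ) L (conjAut c cbar hc2 hcbar τ)) =
      n (resGal (K := ℚ) L τ) + (1 - ψ (resGal (K := ℚ) L τ)) * n (sigmaTilde cbar) := by
  have h1 : n 1 = 0 := by
    have := hn 1 1; rw [mul_one] at this
    -- `n 1 = n 1 + ψ 1 * n 1`, and `ψ 1 * ψ 1 = 1`
    have hψ : ψ 1 * n 1 = 0 := by linear_combination -this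
    have := hψsq 1
    have : n 1 = ψ 1 * (ψ 1 * n 1) := by rw [← mul_assoc, this, one_mul]
    rw [this, hψ, mul_zero]
  have hinv : n (sigmaTilde cbar)⁻¹ = -n (sigmaTilde cbar) := by
    have := hn (sigmaTilde cbar)⁻¹ (sigmaTilde cbar); rw [inv_mul_cancel, h1, hψ2, one_mul] at this
    linear_combination -this
  rw [resGal_conjAut', hn, hn, hψmul, hinv, hψ1, one_mul, one_mul]
  ring

/-! ## §3 The restricted twisted character is the Kummer character of an element of cube norm -/

variable (hθ : cbar (theta L) = -theta L)

include hc2 hcbar hθ in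
/-- ★★ **Twisted `Hom → G₃`.** Let `n : Γ_ℚ → ℤ/3ℤ` be locally constant and `ψ`-twisted (`n(στ) = n(σ) + ψ(σ)n(τ)`) for a
`ψ` with `ψ² = 1`, `ψ ∘ res = ε_L` and `ψ(σ̃) = ψ(σ̃⁻¹) = 1`, and let `√−3 ∉ L`. Then there are `u ∈ L*` and `j` with
`κ_u(τ) = n(res τ) + (ε τ − 1)·j` on `Γ_L` (Kummer theory for the cyclotomic twist, `exists_kummerExp_eq_add`) AND
`u · c(u) = r³` with `c r = r` (Cohen–Pazuki's norm condition `G₃`). [cite: CohenPazuki2009, Definition 1.3 (G₃) and Proposition 1.4 (2)] -/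
theorem exists_kummerExp_eq_resGal_twisted (hL : ∀ q : L, q ^ 2 ≠ -3) (n ψ : Field.absoluteGaloisGroup ℚ → ZMod 3)
    (hn : ∀ σ τ, n (σ * τ) = n σ + ψ σ * n τ) (hlc : IsLocallyConstant n) (hψmul : ∀ σ τ, ψ (σ * τ) = ψ σ * ψ τ)
    (hψsq : ∀ σ, ψ σ * ψ σ = 1) (hψres : ∀ τ : Field.absoluteGaloisGroup L, ψ (resGal (K := ℚ) L τ) = eps τ)
    (hψ1 : ψ (sigmaTilde cbar) = 1) (hψ2 : ψ (sigmaTilde cbar)⁻¹ = 1) :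
    ∃ (u : L) (_ : u ≠ 0) (j : ℕ),
      (∀ τ : Field.absoluteGaloisGroup L, kummerExp u τ = n (resGal (K := ℚ) L τ) + (eps τ - 1) * j) ∧
        ∃ r : L, c r = r ∧ r ≠ 0 ∧ u * c u = r ^ 3 := by
  set n₃ : Field.absoluteGaloisGroup L → ZMod 3 := fun τ => n (resGal (K := ℚ) L τ) with hn₃
  have hn₃mul : ∀ σ τ, n₃ (σ * τ) = n₃ σ + eps σ * n₃ τ := fun σ τ => by
    simp only [hn₃, map_mul, hn, hψres]
  have hlc₃ : IsLocallyConstant n₃ := hlc.comp_continuous (resGal (K := ℚ) L).continuous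
  obtain ⟨u, hu, j, hκ⟩ := exists_kummerExp_eq_add n₃ hn₃mul hlc₃
  refine ⟨u, hu, j, hκ, ?_⟩
  -- the norm condition from conjugation-invariance
  obtain ⟨j₁, hj₁⟩ := kummerExp_conjAut_twisted c hc2 cbar hcbar hθ hu
  refine exists_fixed_cube_of_kummerExp_add c hc2 hL hu (J := n (sigmaTilde cbar) - j₁) fun τ => ?_
  have e1 := hj₁ τ
  have e2 := hκ (conjAut c cbar hc2 hcbar τ)
  rw [eps_conjAut c hc2 cbar hcbar hθ] at e2
  have e3 : n₃ (conjAut c cbar hc2 hcbar τ) = n₃ τ + (1 - eps τ) * n (sigmaTilde cbar) := by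
    simp only [hn₃]
    rw [twistedHom_resGal_conjAut c hc2 cbar hcbar n ψ hn hψmul hψ1 hψ2 hψsq τ, hψres]
  have e4 := hκ τ
  rw [e3] at e2
  -- `κ_u(conjAut τ) = −κ_{cu} τ + (1−ε)j₁ = n₃ τ + (1−ε) nσ̃ + (ε−1) j`, `κ_u τ = n₃ τ + (ε−1) j`
  linear_combination e4 + e1 - e2

/-- For Mathlib's quadratic algebras `L = QuadraticAlgebra ℚ a b` with the conjugation `star` (`⟨x, y⟩ ↦ ⟨x + by, −y⟩`), an element
FIXED by `star` is rational. [cite: CohenPazuki2009, Definition 1.3 (G₃)] -/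
theorem exists_ratCast_eq_of_star_eq {a b : ℚ} {r : QuadraticAlgebra ℚ a b} (h : star r = r) : ∃ q : ℚ, (q : QuadraticAlgebra ℚ a b) = r := by
  have him : (star r).im = r.im := by rw [h]
  rw [QuadraticAlgebra.im_star] at him
  have h0 : r.im = 0 := by linarith
  refine ⟨r.re, ?_⟩
  ext <;> simp [h0]

end OverRat

end TwistedKummer

end Literature.NumberTheory.EllipticCurves

end
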